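import Literature.AnabelianGeometry.Anabelioids.InductionEquivalence
import Mathlib.CategoryTheory.Comma.Over.Pullback
import HarnessLib

/-!
# Induction for `B(G)`, III: orbit maps, and the compatibility `Over.star (G/U) ⋙ fiber ≅ res_U`

Sequel to `Anabelioids/Induction.lean` and `Anabelioids/InductionEquivalence.lean`.  For an open
subgroup `U ⊆ G` of finite index with coset object `S = G ⧸ₐ U`:
* `Induction.orbitHom` — the orbit map `G/K → Y`, `gK ↦ g • y` (`K ⊆ Stab(y)` open), and
  `hom_quotObj_ext` (a map out of a coset object is determined by the image of the base coset);
* `Induction.prod_ext` / `prod_exists` — points of a binary product `S ⨯ X` in `B(G)` (for ANY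
  chosen `HasBinaryProducts` instance) are exactly the pairs of points, tested with orbit maps;
* `Induction.starFiberIso U hU : Over.star (quotObj U hU) ⋙ fiber U hU ≅ ContAction.res _ (inclHom U)`
  — taking the fibre over `eU` of the constant family `G/U × X → G/U` is restriction of `X` to `U`:
  the pull-back functor of `B(U) → B(G)` in the dictionary of [GeoAn] Remark 1.2.2.1
  (S. Mochizuki, *The geometry of anabelioids*, Publ. RIMS 40 (2004), p. 17)
  [cite: MochizukiGeoAn2004, Rem. 1.2.2.1 p.17].
-/

noncomputable section

namespace Literature.AnabelianGeometry.Anabelioids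

open CategoryTheory CategoryTheory.Limits
open Literature.AlgebraicGeometry.Frobenioids (BCat)
open scoped FintypeCatDiscrete Pointwise Topology

universe u

namespace Induction

variable {G : Type u} [Group G] [TopologicalSpace G] [IsTopologicalGroup G]
variable {U : Subgroup G} {hU : IsOpen (U : Set G)} [Finite (G ⧸ U)]

/-! ### Orbit maps out of coset objects -/

omit [Finite (G ⧸ U)] in
/-- The orbit map `G/K → Y`, `gK ↦ g • y`, for an open subgroup `K` fixing `y`.
[cite: MochizukiGeoAn2004, Rem. 1.2.2.1 p.17] -/
def orbitHom (Y : BCat G) (y : Y.obj.V) (K : Subgroup G) [Finite (G ⧸ K)] (hK : IsOpen (K : Set G))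
    (hle : K ≤ MulAction.stabilizer G y) : quotObj K hK ⟶ Y :=
  ObjectProperty.homMk
    { hom := FintypeCat.homMk fun q : G ⧸ K =>
        Quotient.liftOn' q (fun g : G => g • y) fun g g' h => by
          have h' : g⁻¹ * g' ∈ K := QuotientGroup.leftRel_apply.mp h
          have := hle h'
          rw [MulAction.mem_stabilizer_iff, mul_smul, inv_smul_eq_iff] at this
          exact this.symm
      comm := fun x => by
        apply FintypeCat.hom_ext
        intro q
        obtain ⟨g, rfl⟩ := QuotientGroup.mk_surjective (q : G ⧸ K)
        simp only [FintypeCat.comp_apply, FintypeCat.homMk_apply]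
        change Quotient.liftOn' (x • (g : G ⧸ K) : G ⧸ K) _ _ = x • (g • y)
        rw [MulAction.Quotient.smul_coe, smul_eq_mul]
        exact mul_smul x g y }

omit [Finite (G ⧸ U)] in
/-- `orbitHom y (gK) = g • y`. [cite: MochizukiGeoAn2004, Rem. 1.2.2.1 p.17] -/
@[simp] theorem orbitHom_mk (Y : BCat G) (y : Y.obj.V) (K : Subgroup G) [Finite (G ⧸ K)]
    (hK : IsOpen (K : Set G)) (hle : K ≤ MulAction.stabilizer G y) (g : G) :
    (orbitHom Y y K hK hle).hom.hom (((g : G ⧸ K)) : (G ⧸ₐ K).V) = g • y :=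
  rfl

omit [Finite (G ⧸ U)] in
/-- A morphism out of a coset object is determined by the image of the base coset.
[cite: MochizukiGeoAn2004, Rem. 1.2.2.1 p.17] -/
theorem hom_quotObj_ext {K : Subgroup G} [Finite (G ⧸ K)] {hK : IsOpen (K : Set G)} {Y : BCat G}
    (m m' : quotObj K hK ⟶ Y) (h : m.hom.hom (basePt K hK) = m'.hom.hom (basePt K hK)) : m = m' := by
  apply (ObjectProperty.ι _).map_injective
  apply Action.hom_ext
  apply FintypeCat.hom_ext
  intro q
  obtain ⟨g, rfl⟩ := QuotientGroup.mk_surjective (q : G ⧸ K)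
  have e : (((g : G ⧸ K)) : (G ⧸ₐ K).V) = g • basePt K hK := by
    change _ = (((g * 1 : G) : G ⧸ K) : (G ⧸ₐ K).V)
    rw [mul_one]
  change m.hom.hom _ = m'.hom.hom _
  rw [e, hom_smul m.hom, hom_smul m'.hom, h]


/-! ### Generic tools on `B(G)`: the point, fixed points, monomorphisms -/

section Generic

omit [Finite (G ⧸ U)]

/-- The one-point `G`-set `pt` (trivial action) as an object of `B(G)`.
[cite: MochizukiGeoAn2004, Rem. 1.2.2.1 p.17] -/
def ptObj : BCat G :=
  ⟨Action.FintypeCat.ofMulAction G (FintypeCat.of PUnit.{u+1}), by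
    rw [isContinuous_iff]
    intro x
    have : (MulAction.stabilizer G x : Set G) = Set.univ := by
      ext g
      simp only [SetLike.mem_coe, MulAction.mem_stabilizer_iff, Set.mem_univ, iff_true]
      rfl
    rw [this]
    exact isOpen_univ⟩

/-- The unique map to the point. [cite: MochizukiGeoAn2004, Rem. 1.2.2.1 p.17] -/
def toPt (Y : BCat G) : Y ⟶ ptObj :=
  ObjectProperty.homMk
    { hom := FintypeCat.homMk fun _ => PUnit.unit
      comm := fun g => by
        apply FintypeCat.hom_ext
        intro y
        rfl }

/-- `pt` is terminal in `B(G)`. [cite: MochizukiGeoAn2004, Rem. 1.2.2.1 p.17] -/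
def isTerminalPt : IsTerminal (ptObj : BCat G) :=
  IsTerminal.ofUniqueHom toPt fun Y m => by
    apply (ObjectProperty.ι _).map_injective
    apply Action.hom_ext
    apply FintypeCat.hom_ext
    intro y
    rfl

/-- The map `pt → Y` picking a `G`-fixed point. [cite: MochizukiGeoAn2004, Rem. 1.2.2.1 p.17] -/
def ofFixedPoint (Y : BCat G) (y : Y.obj.V) (hy : ∀ g : G, g • y = y) : ptObj ⟶ Y :=
  ObjectProperty.homMk
    { hom := FintypeCat.homMk fun _ => y
      comm := fun g => by
        apply FintypeCat.hom_ext
        intro x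
        simp only [FintypeCat.comp_apply, FintypeCat.homMk_apply]
        exact (hy g).symm }

/-- Unfolding lemma (`ofFixedPoint_apply`). [cite: MochizukiGeoAn2004, Rem. 1.2.2.1 p.17] -/
@[simp] theorem ofFixedPoint_apply (Y : BCat G) (y : Y.obj.V) (hy : ∀ g : G, g • y = y)
    (x : (ptObj : BCat G).obj.V) : (ofFixedPoint Y y hy).hom.hom x = y := rfl

/-- The image of a map `pt → Y` is a `G`-fixed point. [cite: MochizukiGeoAn2004, Rem. 1.2.2.1 p.17] -/
theorem smul_hom_pt {Y : BCat G} (f : ptObj ⟶ Y) (g : G) (x : (ptObj : BCat G).obj.V) :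
    g • f.hom.hom x = f.hom.hom x := by
  rw [← hom_smul f.hom g x]
  rfl

variable [CompactSpace G]

/-- **Monomorphisms of `B(G)` are injective** on underlying sets (`G` compact): test two points
with equal image against the orbit maps out of `G/(Stab x ∩ Stab y)`.
[cite: MochizukiGeoAn2004, Rem. 1.2.2.1 p.17] -/
theorem injective_of_mono {T₁ T₂ : BCat G} (m : T₁ ⟶ T₂) [Mono m] :
    Function.Injective (fun x : T₁.obj.V => m.hom.hom x) := by
  classical
  intro x y hxy
  set K : Subgroup G := MulAction.stabilizer G x ⊓ MulAction.stabilizer G y with hKdef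
  have hKopen : IsOpen (K : Set G) := by
    rw [hKdef, Subgroup.coe_inf]
    exact ((isContinuous_iff _).mp T₁.property x).inter ((isContinuous_iff _).mp T₁.property y)
  haveI : Finite (G ⧸ K) := Subgroup.quotient_finite_of_isOpen K hKopen
  let a : quotObj K hKopen ⟶ T₁ := orbitHom T₁ x K hKopen inf_le_left
  let b : quotObj K hKopen ⟶ T₁ := orbitHom T₁ y K hKopen inf_le_right
  have ha : a.hom.hom (basePt K hKopen) = x := by
    change (orbitHom T₁ x K hKopen inf_le_left).hom.hom ((((1 : G) : G ⧸ K)) : (G ⧸ₐ K).V) = x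
    rw [orbitHom_mk, one_smul]
  have hb : b.hom.hom (basePt K hKopen) = y := by
    change (orbitHom T₁ y K hKopen inf_le_right).hom.hom ((((1 : G) : G ⧸ K)) : (G ⧸ₐ K).V) = y
    rw [orbitHom_mk, one_smul]
  have e : a ≫ m = b ≫ m := by
    apply hom_quotObj_ext
    simp only [ObjectProperty.FullSubcategory.comp_hom, Action.comp_hom, FintypeCat.comp_apply]
    rw [ha, hb]
    exact hxy
  have e' : a = b := (cancel_mono m).mp e
  rw [← ha, ← hb, e']

end Generic


section Star

/-! ### Compatibility with restriction: `Over.star (G/U) ⋙ fiber ≅ res_U` -/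

variable (U) in
/-- The inclusion `U ↪ G` as a continuous homomorphism. [cite: MochizukiGeoAn2004, Rem. 1.2.2.1 p.17] -/
def inclHom : U →ₜ* G :=
  { U.subtype with continuous_toFun := continuous_subtype_val }

omit [IsTopologicalGroup G] [Finite (G ⧸ U)] in
/-- `inclHom U u = u`. [cite: MochizukiGeoAn2004, Rem. 1.2.2.1 p.17] -/
@[simp] theorem inclHom_apply (u : U) : inclHom U u = (u : G) := rfl

variable [HasBinaryProducts (BCat G)]

/-- The fibre of `pr₁ : G/U × X → G/U` over `eU` maps to `X` by the second projection.
[cite: MochizukiGeoAn2004, Rem. 1.2.2.1 p.17] -/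
def starFiberFun (X : BCat G) (p : Fiber ((Over.star (quotObj U hU)).obj X)) : X.obj.V :=
  (Limits.prod.snd : quotObj U hU ⨯ X ⟶ X).hom.hom p.1

omit [IsTopologicalGroup G] in
/-- Elementwise `prod.lift`: the first component. [cite: MochizukiGeoAn2004, Rem. 1.2.2.1 p.17] -/
theorem prod_fst_lift_apply {W S X : BCat G} (a : W ⟶ S) (b : W ⟶ X) (w : W.obj.V) :
    (Limits.prod.fst : S ⨯ X ⟶ S).hom.hom ((Limits.prod.lift a b).hom.hom w) = a.hom.hom w := by
  have h := congrArg (fun φ : W ⟶ S => φ.hom.hom w) (Limits.prod.lift_fst a b)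
  simp only [ObjectProperty.FullSubcategory.comp_hom, Action.comp_hom, FintypeCat.comp_apply] at h
  exact h

omit [IsTopologicalGroup G] in
/-- Elementwise `prod.lift`: the second component. [cite: MochizukiGeoAn2004, Rem. 1.2.2.1 p.17] -/
theorem prod_snd_lift_apply {W S X : BCat G} (a : W ⟶ S) (b : W ⟶ X) (w : W.obj.V) :
    (Limits.prod.snd : S ⨯ X ⟶ X).hom.hom ((Limits.prod.lift a b).hom.hom w) = b.hom.hom w := by
  have h := congrArg (fun φ : W ⟶ X => φ.hom.hom w) (Limits.prod.lift_snd a b)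
  simp only [ObjectProperty.FullSubcategory.comp_hom, Action.comp_hom, FintypeCat.comp_apply] at h
  exact h

/-- The structure map of `(Over.star (G/U)).obj X` is the first projection, pointwise
(Mathlib: `((Over.star S).obj X).hom = prod.lift prod.fst (𝟙 _) ≫ prod.fst`).
[cite: MochizukiGeoAn2004, Rem. 1.2.2.1 p.17] -/
theorem star_hom_apply (X : BCat G) (q : (quotObj U hU ⨯ X).obj.V) :
    ((Over.star (quotObj U hU)).obj X).hom.hom.hom q =
      (Limits.prod.fst : quotObj U hU ⨯ X ⟶ quotObj U hU).hom.hom q := by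
  have e := Over.star_obj_hom (quotObj U hU) X
  simp only [Limits.prod.lift_fst] at e
  exact congrArg (fun φ : (quotObj U hU ⨯ X ⟶ quotObj U hU) => φ.hom.hom q) e

/-- On the fibre of `(Over.star (G/U)).obj X`, the first projection is the base coset.
[cite: MochizukiGeoAn2004, Rem. 1.2.2.1 p.17] -/
theorem fiber_star_fst (X : BCat G) (p : Fiber ((Over.star (quotObj U hU)).obj X)) :
    (Limits.prod.fst : quotObj U hU ⨯ X ⟶ quotObj U hU).hom.hom p.1 = basePt U hU :=
  (star_hom_apply X p.1).symm.trans p.2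

/-- Conversely, a point of `G/U × X` with first projection `eU` lies in that fibre.
[cite: MochizukiGeoAn2004, Rem. 1.2.2.1 p.17] -/
theorem mem_fiber_star (X : BCat G) (q : (quotObj U hU ⨯ X).obj.V)
    (hq : (Limits.prod.fst : quotObj U hU ⨯ X ⟶ quotObj U hU).hom.hom q = basePt U hU) :
    ((Over.star (quotObj U hU)).obj X).hom.hom.hom q = basePt U hU :=
  (star_hom_apply X q).trans hq

/-- The second projection on the fibre is `U`-equivariant. [cite: MochizukiGeoAn2004, Rem. 1.2.2.1 p.17] -/
theorem starFiberFun_smul (X : BCat G) (u : U) (p : Fiber ((Over.star (quotObj U hU)).obj X)) :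
    starFiberFun X (u • p) = (u : G) • starFiberFun X p := by
  unfold starFiberFun
  rw [Fiber.smul_val]
  exact hom_smul _ (u : G) p.1

variable [CompactSpace G]

/-- **Points of a product of finite continuous `G`-sets are determined by their projections**
(for any chosen binary product in `B(G)`), tested against orbit maps out of coset objects.
[cite: MochizukiGeoAn2004, Rem. 1.2.2.1 p.17] -/
theorem prod_ext {S X : BCat G} (p p' : (S ⨯ X).obj.V)
    (h1 : (Limits.prod.fst : S ⨯ X ⟶ S).hom.hom p = (Limits.prod.fst : S ⨯ X ⟶ S).hom.hom p')
    (h2 : (Limits.prod.snd : S ⨯ X ⟶ X).hom.hom p = (Limits.prod.snd : S ⨯ X ⟶ X).hom.hom p') :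
    p = p' := by
  classical
  -- a coset object mapping to both points
  set K : Subgroup G := MulAction.stabilizer G p ⊓ MulAction.stabilizer G p' with hKdef
  have hKopen : IsOpen (K : Set G) := by
    rw [hKdef, Subgroup.coe_inf]
    exact ((isContinuous_iff _).mp (S ⨯ X).property p).inter ((isContinuous_iff _).mp (S ⨯ X).property p')
  haveI : Finite (G ⧸ K) := Subgroup.quotient_finite_of_isOpen K hKopen
  let m : quotObj K hKopen ⟶ S ⨯ X := orbitHom (S ⨯ X) p K hKopen inf_le_left
  let m' : quotObj K hKopen ⟶ S ⨯ X := orbitHom (S ⨯ X) p' K hKopen inf_le_right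
  have hm : m.hom.hom (basePt K hKopen) = p := by
    change (orbitHom (S ⨯ X) p K hKopen inf_le_left).hom.hom ((((1 : G) : G ⧸ K)) : (G ⧸ₐ K).V) = p
    rw [orbitHom_mk, one_smul]
  have hm' : m'.hom.hom (basePt K hKopen) = p' := by
    change (orbitHom (S ⨯ X) p' K hKopen inf_le_right).hom.hom ((((1 : G) : G ⧸ K)) : (G ⧸ₐ K).V) = p'
    rw [orbitHom_mk, one_smul]
  have e1 : m ≫ Limits.prod.fst = m' ≫ Limits.prod.fst := by
    apply hom_quotObj_ext
    simp only [ObjectProperty.FullSubcategory.comp_hom, Action.comp_hom, FintypeCat.comp_apply]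
    rw [hm, hm', h1]
  have e2 : m ≫ Limits.prod.snd = m' ≫ Limits.prod.snd := by
    apply hom_quotObj_ext
    simp only [ObjectProperty.FullSubcategory.comp_hom, Action.comp_hom, FintypeCat.comp_apply]
    rw [hm, hm', h2]
  have e : m = m' := Limits.prod.hom_ext e1 e2
  rw [← hm, ← hm', e]

/-- **Every pair of points is realised in the product** (for any chosen binary product in
`B(G)`): via `prod.lift` of two orbit maps. [cite: MochizukiGeoAn2004, Rem. 1.2.2.1 p.17] -/
theorem prod_exists {S X : BCat G} (s : S.obj.V) (x : X.obj.V) :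
    ∃ p : (S ⨯ X).obj.V, (Limits.prod.fst : S ⨯ X ⟶ S).hom.hom p = s ∧
      (Limits.prod.snd : S ⨯ X ⟶ X).hom.hom p = x := by
  classical
  set K : Subgroup G := MulAction.stabilizer G s ⊓ MulAction.stabilizer G x with hKdef
  have hKopen : IsOpen (K : Set G) := by
    rw [hKdef, Subgroup.coe_inf]
    exact ((isContinuous_iff _).mp S.property s).inter ((isContinuous_iff _).mp X.property x)
  haveI : Finite (G ⧸ K) := Subgroup.quotient_finite_of_isOpen K hKopen
  let a : quotObj K hKopen ⟶ S := orbitHom S s K hKopen inf_le_left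
  let b : quotObj K hKopen ⟶ X := orbitHom X x K hKopen inf_le_right
  refine ⟨(Limits.prod.lift a b).hom.hom (basePt K hKopen), ?_, ?_⟩
  · rw [prod_fst_lift_apply]
    change (orbitHom S s K hKopen inf_le_left).hom.hom ((((1 : G) : G ⧸ K)) : (G ⧸ₐ K).V) = s
    rw [orbitHom_mk, one_smul]
  · rw [prod_snd_lift_apply]
    change (orbitHom X x K hKopen inf_le_right).hom.hom ((((1 : G) : G ⧸ K)) : (G ⧸ₐ K).V) = x
    rw [orbitHom_mk, one_smul]

/-- The fibre of `G/U × X → G/U` over `eU` is `X`: bijectivity of the second projection.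
[cite: MochizukiGeoAn2004, Rem. 1.2.2.1 p.17] -/
theorem starFiberFun_bijective (X : BCat G) : Function.Bijective (starFiberFun (hU := hU) X) := by
  constructor
  · intro p p' h
    apply Subtype.ext
    exact prod_ext p.1 p'.1 ((fiber_star_fst X p).trans (fiber_star_fst X p').symm) h
  · intro x
    obtain ⟨p, hp1, hp2⟩ := prod_exists (S := quotObj U hU) (basePt U hU) x
    exact ⟨⟨p, mem_fiber_star X p hp1⟩, hp2⟩

variable (U hU) in
/-- **`Over.star (G/U) ⋙ fiber ≅ res_U`**: taking the fibre over `eU` of the "constant" family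
`G/U × X → G/U` recovers `X` with its action restricted to `U` — the compatibility of the
induction dictionary with restriction ([GeoAn] Rem. 1.2.2.1: the pull-back functor of
`B(U) → B(G)` "is" `X ↦ X|_U`). [cite: MochizukiGeoAn2004, Rem. 1.2.2.1 p.17] -/
def starFiberIso :
    Over.star (quotObj U hU) ⋙ fiber U hU ≅ ContAction.res FintypeCat.{u} (inclHom U) :=
  NatIso.ofComponents
    (fun X => ObjectProperty.isoMk _
      (Action.mkIso (FintypeCat.equivEquivIso (Equiv.ofBijective _ (starFiberFun_bijective X)))
        fun u => by
          apply FintypeCat.hom_ext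
          intro p
          simp only [FintypeCat.comp_apply]
          change starFiberFun X (u • p) = (u : G) • starFiberFun X p
          exact starFiberFun_smul X u p))
    (fun {X X'} k => by
      apply (ObjectProperty.ι _).map_injective
      apply Action.hom_ext
      apply FintypeCat.hom_ext
      intro p
      simp only [Functor.comp_map, Functor.map_comp]
      change starFiberFun X' (fiberFun ((Over.star (quotObj U hU)).map k) p) =
        k.hom.hom (starFiberFun X p)
      unfold starFiberFun
      change (Limits.prod.snd : quotObj U hU ⨯ X' ⟶ X').hom.hom
          (((Over.star (quotObj U hU)).map k).left.hom.hom p.1) = _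
      have h := congrArg (fun φ : quotObj U hU ⨯ X ⟶ X' => φ.hom.hom p.1)
        (Limits.prod.map_snd (𝟙 (quotObj U hU)) k)
      simp only [ObjectProperty.FullSubcategory.comp_hom, Action.comp_hom, FintypeCat.comp_apply] at h
      have hk : ((Over.star (quotObj U hU)).map k).left = Limits.prod.map (𝟙 _) k :=
        Over.star_map_left _ _
      exact (congrArg (fun φ : quotObj U hU ⨯ X ⟶ quotObj U hU ⨯ X' =>
        (Limits.prod.snd : quotObj U hU ⨯ X' ⟶ X').hom.hom (φ.hom.hom p.1)) hk).trans h)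


end Star

end Induction

end Literature.AnabelianGeometry.Anabelioids

end
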